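import Mathlib
import Summits.Ventures.PercRepro2.SwAllHMarkDefs
import Summits.Ventures.PercRepro2.SwAllFreeBits
import Summits.Ventures.PercRepro2.SwAllHMarkSwap

/-!
# THE MARK WITH NEIGHBOURS `p` AND `h` ONLY, III: the theorem
(blind cell PercRepro2, night-4 g30, 2026-08-28; proofs/NIGHT4-G30.md)

**`IsHMarkAt.swAll_hMark`**: with every edge at `x` joining `x` to `p` or to `h` and `x ≠ l`, row
2′SW-ALL with the mark at `x` follows from the row with the mark at `p` ON THE GRAPH WITH THE
EDGES AT `x` DELETED (`isolate ends x`).  PROOF (counting form + Hall).  The side `Q_x` splits by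
`p ∈ C_B(l)` (clusters of the isolated graph).  PART `A` (`p ∉ C_B(l)`) is the side `Q_p` of the
isolated graph intersected with a PATTERN on the bits of the edges at `x` (some edge `x–p` red,
every edge `x–h` blue; `IsHMarkAt.mem_tgt_iff`); the isolated graph does not see those bits
(`Q_p` is saturated, both edge sets of `h` are blind), so its counting inequality
(`card_le_of_swAll`) restricts to the pattern by FREE BITS (`card_filter_le_of_free_bits`); on
`Q_x` the red edge set of `h` is that of the isolated graph (`IsHMarkAt.redEdges_eq`) and the
blue one contains it (`blueEdges_isolate_subset`), so the restricted inequality is the one wanted.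
PART `B` (`p ∈ C_B(l)`): the colour swap off the edges at `x` is an injection of the red count
into the blue count (`IsHMarkAt.swapOff_mem`, `blueEdges_isolate_swapOff`).  Hence
`IsHMarkAt.card_le_hMark`, and Hall (`exists_swAll_injection_of_card_le`) gives the injection.
`IsHMarkAt.sw_hMark` is row (SW); `swAll_mark_self` (the side of the mark `l` is empty) gives
**`IsHMarkAt.swAll_of_hMark_l`**: the row holds outright when every edge at `x` goes to `l` or `h`.
The leaf at `p` (no edge to `h`) is the special case `IsLeafAt.swAll_hMark`.
-/

namespace Summit.Ventures.PercRepro2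

namespace LocRows

open Hull

variable {V : Type*} {E : Type*} [Fintype E] [DecidableEq E]

open scoped Classical

section Theorem

variable {ends : E → Sym2 V} {x p h l : V} (hm : IsHMarkAt ends x p h) (hxl : x ≠ l)
include hm hxl

/-- **The rigid counting inequality on the side of the H-mark** from row 2′SW-ALL with the mark
at `p` on the isolated graph. -/
theorem IsHMarkAt.card_le_hMark (hp : SwAll (isolate ends x) l h p) (𝓔 : Set (Set E))
    (h𝓔 : IsUpperSet 𝓔) :
    ((tgtU ends l h {S : Set V | x ∈ S}).filter fun ζ => redEdges ends ζ h ∈ 𝓔).card ≤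
      ((tgtU ends l h {S : Set V | x ∈ S}).filter fun ζ => blueEdges ends ζ h ∈ 𝓔).card := by
  have hhx : h ≠ x := hm.xh.symm
  set Qx := tgtU ends l h {S : Set V | x ∈ S} with hQx
  set Qp := tgtU (isolate ends x) l h {S : Set V | p ∈ S} with hQp
  set SR := Qx.filter fun ζ => redEdges ends ζ h ∈ 𝓔 with hSR
  set SB := Qx.filter fun ζ => blueEdges ends ζ h ∈ 𝓔 with hSB
  have hsplitR := Finset.card_filter_add_card_filter_not
    (s := SR) (p := fun ζ => p ∈ cluster (isolate ends x) (blue ζ) l)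
  have hsplitB := Finset.card_filter_add_card_filter_not
    (s := SB) (p := fun ζ => p ∈ cluster (isolate ends x) (blue ζ) l)
  -- part B: the colour swap off the edges at `x`
  have hB : (SR.filter fun ζ => p ∈ cluster (isolate ends x) (blue ζ) l).card ≤
      (SB.filter fun ζ => p ∈ cluster (isolate ends x) (blue ζ) l).card := by
    refine Finset.card_le_card_of_injOn (swapOff ends x) ?_ ?_
    · intro ζ hζ
      simp only [hSR, hSB, Finset.mem_coe, Finset.mem_filter] at hζ ⊢
      obtain ⟨⟨hQ, hR⟩, hq⟩ := hζ
      obtain ⟨hQ', hq'⟩ := hm.swapOff_mem hxl hQ hq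
      refine ⟨⟨hQ', h𝓔 ?_ hR⟩, hq'⟩
      rw [hm.redEdges_eq hQ, ← blueEdges_isolate_swapOff hhx ζ]
      exact blueEdges_isolate_subset hhx
    · intro ζ₁ _ ζ₂ _ heq
      have := congrArg (swapOff ends x) heq
      rwa [swapOff_swapOff, swapOff_swapOff] at this
  -- part A: the side of `p` of the isolated graph, restricted to the pattern at `x`
  have hA : (SR.filter fun ζ => ¬ p ∈ cluster (isolate ends x) (blue ζ) l).card ≤
      (SB.filter fun ζ => ¬ p ∈ cluster (isolate ends x) (blue ζ) l).card := by
    let D : Set E := {e | x ∈ ends e}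
    -- the pattern, kept opaque so that every `filter Pat` carries the same (classical) instance
    obtain ⟨Pat, hPat_def⟩ : ∃ Pat : Config E → Prop, ∀ ζ, Pat ζ ↔
        (∃ e, ends e = s(x, p) ∧ ζ e = true) ∧ ∀ g, ends g = s(x, h) → ζ g = false :=
      ⟨_, fun _ => Iff.rfl⟩
    have hS : ∀ ζ ∈ Qp, ∀ ζ', (∀ e, e ∉ D → ζ' e = ζ e) → ζ' ∈ Qp := by
      intro ζ hζ ζ' hag
      have hag' : ∀ e, x ∉ ends e → ζ' e = ζ e := hag
      have hagb : ∀ e, x ∉ ends e → blue ζ' e = blue ζ e := fun e he => by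
        rw [blue_apply, blue_apply, hag' e he]
      rw [hQp, LocRows.mem_tgt_iff] at hζ ⊢
      simp only [hull] at hζ ⊢
      rw [cluster_isolate_eq_of_agree hag' l, cluster_isolate_eq_of_agree hagb l]
      exact hζ
    have hPR : ∀ ζ ζ', (∀ e, e ∉ D → ζ' e = ζ e) →
        redEdges (isolate ends x) ζ h ∈ 𝓔 → redEdges (isolate ends x) ζ' h ∈ 𝓔 := by
      intro ζ ζ' hag hR
      rw [redEdges_isolate_eq_of_agree hhx hag]
      exact hR
    have hPB : ∀ ζ ζ', (∀ e, e ∉ D → ζ' e = ζ e) →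
        blueEdges (isolate ends x) ζ h ∈ 𝓔 → blueEdges (isolate ends x) ζ' h ∈ 𝓔 := by
      intro ζ ζ' hag hBl
      rw [blueEdges_isolate_eq_of_agree hhx hag]
      exact hBl
    have hPat : ∀ ζ ζ', (∀ e, e ∈ D → ζ' e = ζ e) → Pat ζ → Pat ζ' := by
      intro ζ ζ' hag hζ
      rw [hPat_def] at hζ ⊢
      obtain ⟨⟨e, he, hred⟩, hg⟩ := hζ
      refine ⟨⟨e, he, ?_⟩, fun g hg' => ?_⟩
      · rw [hag e (by show x ∈ ends e; rw [he]; exact Sym2.mem_mk_left _ _)]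
        exact hred
      · rw [hag g (by show x ∈ ends g; rw [hg']; exact Sym2.mem_mk_left _ _)]
        exact hg g hg'
    have hle : (Qp.filter fun ζ => redEdges (isolate ends x) ζ h ∈ 𝓔).card ≤
        (Qp.filter fun ζ => blueEdges (isolate ends x) ζ h ∈ 𝓔).card :=
      card_le_of_swAll hp 𝓔 h𝓔
    have key := card_filter_le_of_free_bits (D := D) Qp hS _ _ hPR hPB Pat hPat hle
    -- the red side of part `A` is the red side of `Q_p` on the pattern
    have eR : (SR.filter fun ζ => ¬ p ∈ cluster (isolate ends x) (blue ζ) l) =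
        (Qp.filter fun ζ => redEdges (isolate ends x) ζ h ∈ 𝓔).filter Pat := by
      ext ζ
      simp only [hSR, Finset.mem_filter, hPat_def]
      constructor
      · rintro ⟨⟨hQ, hR⟩, hq⟩
        obtain ⟨hh, hpat1, hpR, hg, -⟩ := (hm.mem_tgt_iff hxl).1 hQ
        refine ⟨⟨?_, ?_⟩, hpat1, hg⟩
        · rw [hQp, LocRows.mem_tgt_iff]
          exact ⟨hh, hpR, hq⟩
        · rw [← hm.redEdges_eq hQ]
          exact hR
      · rintro ⟨⟨hQ, hR⟩, hpat1, hg⟩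
        rw [hQp, LocRows.mem_tgt_iff] at hQ
        obtain ⟨hh, hpR, hpB⟩ := hQ
        have hQx' : ζ ∈ Qx :=
          (hm.mem_tgt_iff hxl).2 ⟨hh, hpat1, hpR, hg, fun h' => absurd h' hpB⟩
        exact ⟨⟨hQx', by rw [hm.redEdges_eq hQx']; exact hR⟩, hpB⟩
    -- the blue side of `Q_p` on the pattern lies in the blue side of part `A`
    have eB : ((Qp.filter fun ζ => blueEdges (isolate ends x) ζ h ∈ 𝓔).filter Pat) ⊆
        SB.filter fun ζ => ¬ p ∈ cluster (isolate ends x) (blue ζ) l := by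
      intro ζ hζ
      simp only [hSB, Finset.mem_filter, hPat_def] at hζ ⊢
      obtain ⟨⟨hQ, hBl⟩, hpat1, hg⟩ := hζ
      rw [hQp, LocRows.mem_tgt_iff] at hQ
      obtain ⟨hh, hpR, hpB⟩ := hQ
      have hQx' : ζ ∈ Qx :=
        (hm.mem_tgt_iff hxl).2 ⟨hh, hpat1, hpR, hg, fun h' => absurd h' hpB⟩
      exact ⟨⟨hQx', h𝓔 (blueEdges_isolate_subset hhx) hBl⟩, hpB⟩
    rw [eR]
    exact key.trans (Finset.card_le_card eB)
  omega

/-- **THE H-MARK STEP**: row 2′SW-ALL with the mark at `x ≠ l`, every edge at `x` joining `x` to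
`p` or to `h`, follows from the row with the mark at `p` on the graph with the edges at `x`
deleted. -/
theorem IsHMarkAt.swAll_hMark (hp : SwAll (isolate ends x) l h p) : SwAll ends l h x :=
  exists_swAll_injection_of_card_le h _ (hm.card_le_hMark hxl hp)

/-- **Row (SW) with the H-mark** from row 2′SW-ALL with the mark at `p` on the isolated graph. -/
theorem IsHMarkAt.sw_hMark (hp : SwAll (isolate ends x) l h p) : Sw ends l h x :=
  sw_of_swAll ends (hm.swAll_hMark hxl hp)

end Theorem

section Corollaries

variable {ends : E → Sym2 V} {x p h l : V}

/-- The side of the mark `l` is empty (`l ∈ C_B(l)`): row 2′SW-ALL with the mark at `l` holds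
vacuously. -/
lemma swAll_mark_self (ends : E → Sym2 V) (l h : V) : SwAll ends l h l := by
  refine ⟨fun ζ => ζ.1, fun _ _ h12 => Subtype.ext h12, ?_⟩
  rintro ⟨ζ, hζ⟩
  exfalso
  rw [LocRows.mem_tgt_iff] at hζ
  exact hζ.2.2 (mem_cluster_self _ _ _)

/-- **The mark with neighbours `l` and `h` only**: row 2′SW-ALL holds outright. -/
theorem IsHMarkAt.swAll_of_hMark_l (hm : IsHMarkAt ends x l h) (hxl : x ≠ l) :
    SwAll ends l h x :=
  hm.swAll_hMark hxl (swAll_mark_self _ _ _)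

omit [Fintype E] [DecidableEq E] in
/-- A leaf at `p` is an H-mark vertex (no edge to `h`). -/
lemma IsLeafAt.isHMarkAt {e : E} (hleaf : IsLeafAt ends x p e) (hxh : x ≠ h) :
    IsHMarkAt ends x p h where
  xp := hleaf.up
  xh := hxh
  edges := fun e' he' => Or.inl (by rw [hleaf.only e' he']; exact hleaf.ends₁)

/-- **The leaf-mark step through the H-mark step**: row 2′SW-ALL with the mark at a leaf `x` of
`p` from the row with the mark at `p` on the graph with the leaf deleted. -/
theorem IsLeafAt.swAll_hMark {e : E} (hleaf : IsLeafAt ends x p e) (hxl : x ≠ l) (hxh : x ≠ h)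
    (hp : SwAll (isolate ends x) l h p) : SwAll ends l h x :=
  (hleaf.isHMarkAt hxh).swAll_hMark hxl hp

end Corollaries

end LocRows

end Summit.Ventures.PercRepro2
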